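import Summits.KontsevichZagierPeriods.KontsevichZagierPeriods.Theorems.HermiteRigidityReductionRigidityMultiLevelNormalForm
import Summits.KontsevichZagierPeriods.KontsevichZagierPeriods.Theorems.HermiteRigidityReductionRigidityDupTowerNormalForm

/-!
# `ReductionRigidity` (stmt-KontsevichZagierPeriods-3407), line `Sketch`: EVERY finite set of rational levels with jointly
# rigid values is an island (`stub_multiLevelKernelGen`); the consecutive powers `N, N², …, N^D` UNCONDITIONALLY
# (`stub_powerLevelsKernelUnconditional`)

Route `KontsevichZagierPeriods/HermiteRigidity`, crux `ReductionRigidity` (stmt-3407, summit-equivalent; skeleton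
`Cruxes/ReductionRigidity/Lines/Sketch.lean` v7). Lead seat c7, growth item G16. The structural half of every multi-level island
so far (Landen join, duplication joins and towers) isolated as one theorem: on the box sector generated by all rescaled box
generators `[□ʲ, q x^a/(ν_k − ∏x)^m]` (`j ≤ w`, `q ∈ ℚ`) at finitely many rational levels `ν_0, …, ν_{K−1}` (each `> 1` or `< 0`),
Conjecture 1 of Kontsevich–Zagier holds in kernel form as soon as `1` and the normal-form values `∫_□ⁱ dp/(ν_k − ∏p)`
(`1 ≤ i ≤ w`, `k < K`; `= Li_i(1/ν_k)`) are `ℚ`-linearly independent — no cross-level move is needed, the kernel being generated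
by the single-level kernels (`stub_multiLevelKernelGen`, over the multi-level normal form `stub_multiLevelNormalForm`). The
rigidity is a THEOREM of the tree for the consecutive powers `ν_k = N^{k+1}` (`k < D`):
`Literature.NumberTheory.DiophantineApproximation.one_polylog_powers_linearIndependent` (`1, Li_s(1/N^d)`, `d ≤ D`, `s ≤ w`,
are `ℚ`-independent when every `d ≤ D` divides some `m` with `log N ≥ 4m²(w+1)³` — the distinct-shifts theorem at `y = 1/N^m`
through the divisor bridge), used with `m = (D+1)!` in the sibling file `…PowerLevelsUnconditional.lean`
(`stub_powerLevelsKernelUnconditional`, an unconditional island on the `D` levels `N, N², …, N^D`).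

References: M. Kontsevich, D. Zagier, *Periods* (2001), §1.2 [cite: KontsevichZagier2001, §1.2]; S. David, N. Hirata-Kohno,
M. Kawashima, Moscow J. Comb. Number Theory 9 (2020), Thm 2.1 [cite: DavidHirataKohnoKawashima2020, Thm 2.1]. No definitions
are introduced.
-/

noncomputable section

open MeasureTheory Set MvPolynomial

namespace Summit.KontsevichZagierPeriods.HermiteRigidity.ReductionRigidity

open Literature.NumberTheory.Transcendental
open Literature.NumberTheory.Transcendental.KZ

/-- **Stub `stub_multiLevelKernelGen`** (sub-goal of crux `ReductionRigidity`, stmt-3407, line `Sketch`, lead c7, growth G16):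
**finitely many rational levels with jointly rigid values form an island.** For `w`, `K` and rational levels `L k` (each `> 1`
or `< 0`): IF `1` and the numbers `∫_□ⁱ dp/(L_k − ∏p)` (`1 ≤ i ≤ w`, `k < K`) are `ℚ`-linearly independent, THEN every
`ℤ`-combination of value `0` of rescaled box generators `[□ʲ, q x^a/(L_k − ∏x)^m]` (`j ≤ w`, `k < K`) lies in `KZ.relations`
(normal form `stub_multiLevelNormalForm`, values `eval_nfRep`, vanishing carriers, the `K` constants by `sum_carriers_zero`).
[cite: KontsevichZagier2001, §1.2] -/
theorem stub_multiLevelKernelGen : ∀ (w K : ℕ) (L : ℕ → ℚ), (∀ k, 1 < L k ∨ L k < 0) →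
    (∀ (a : ℚ) (b : ℕ → ℕ → ℚ),
      (a : ℝ) + ∑ k ∈ Finset.range K, ∑ i ∈ Finset.range w,
          (b k i : ℝ) * (∫ p in cube (i + 1), 1 / ((L k : ℝ) - ∏ l, p l)) = 0 →
        a = 0 ∧ ∀ k ∈ Finset.range K, ∀ i ∈ Finset.range w, b k i = 0) →
    ∀ c ∈ AddSubgroup.closure
      {c | ∃ (k j : ℕ) (r : IntegralRep j) (q : ℚ) (a : Fin j → ℕ) (m : ℕ), k < K ∧ j ≤ w ∧ r.domain = cube j ∧
          EqOn r.integrand (fun p => (q : ℝ) * (∏ l, p l ^ a l) / ((L k : ℝ) - ∏ l, p l) ^ m) (cube j) ∧ c = KZ.of r},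
      KZ.eval c = 0 → c ∈ KZ.relations := by
  intro w K L hL hrig c hc h0
  obtain ⟨α, s, hs, hrel⟩ := stub_multiLevelNormalForm w K L hL c hc
  -- VALUES of the normal forms
  set I : ℕ → ℝ → ℝ := fun i ν => ∫ p in cube i, 1 / (ν - ∏ l, p l) with hI
  have evs : ∀ k i, KZ.eval (KZ.of (s k i)) = (α k i : ℝ) * I i (L k) := fun k i => by
    rw [eval_nfRep (ν := L k) (α := α k i) (hs k i).1 (hs k i).2]
  have I0 : ∀ k, I 0 (L k) = 1 / ((L k : ℝ) - 1) := fun k => integral_cube_zero_level (L k)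
  -- the value of `c`, in the shape of the rigidity hypothesis
  have e := eval_eq_zero_of_mem_relations hrel
  rw [map_sub, h0, zero_sub, neg_eq_zero, map_sum] at e
  simp only [map_sum, evs] at e
  simp only [Finset.sum_range_succ', I0, Finset.sum_add_distrib] at e
  have h1 : ∑ k ∈ Finset.range K, (α k 0 : ℝ) * (1 / ((L k : ℝ) - 1)) =
      ∑ k ∈ Finset.range K, (α k 0 : ℝ) / ((L k : ℝ) - 1) :=
    Finset.sum_congr rfl fun k _ => by ring
  rw [h1] at e
  simp only [hI] at e
  have hval : (((∑ k ∈ Finset.range K, α k 0 / (L k - 1) : ℚ)) : ℝ) +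
      ∑ k ∈ Finset.range K, ∑ i ∈ Finset.range w,
        (α k (i + 1) : ℝ) * (∫ p in cube (i + 1), 1 / ((L k : ℝ) - ∏ l, p l)) = 0 := by
    push_cast
    linear_combination e
  obtain ⟨hA, hα⟩ := hrig _ (fun k i => α k (i + 1)) hval
  -- RELATIONS: the surviving carriers of positive dimension vanish one by one
  have hS : ∀ k ∈ Finset.range K, ∀ i ∈ Finset.range w, KZ.of (s k (i + 1)) ∈ KZ.relations := fun k hk i hi =>
    carrier_zero (D := cube (i + 1)) (fun b p => (b : ℝ) / ((L k : ℝ) - ∏ l, p l)) (fun p => by simp) (hs k (i + 1)).1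
      (fun p hp => by rw [(hs k (i + 1)).2 hp, show α k (i + 1) = 0 from hα k hk i hi])
  -- dimension zero: `K` constants summing to `0`
  have hZ : ∑ k ∈ Finset.range K, KZ.of (s k 0) ∈ KZ.relations := by
    refine sum_carriers_zero (D := cube 0) (fun b _ => (b : ℝ)) (fun b b' p => by push_cast; ring) (fun p => by simp)
      (fun b => exists_nf0 b) (fun k => α k 0 / (L k - 1)) (fun k => s k 0) (fun k => ?_) hA
    exact ⟨(hs k 0).1, fun p hp => by rw [(hs k 0).2 hp]; simp [Finset.univ_eq_empty]⟩
  -- all together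
  have hNF : ∑ k ∈ Finset.range K, ∑ i ∈ Finset.range (w + 1), KZ.of (s k i) =
      ∑ k ∈ Finset.range K, ∑ i ∈ Finset.range w, KZ.of (s k (i + 1)) + ∑ k ∈ Finset.range K, KZ.of (s k 0) := by
    simp only [Finset.sum_range_succ', Finset.sum_add_distrib]
  have : c = (c - ∑ k ∈ Finset.range K, ∑ i ∈ Finset.range (w + 1), KZ.of (s k i)) +
      ∑ k ∈ Finset.range K, ∑ i ∈ Finset.range (w + 1), KZ.of (s k i) := by abel
  rw [this]
  refine KZ.relations.add_mem hrel ?_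
  rw [hNF]
  exact KZ.relations.add_mem (KZ.relations.sum_mem fun k hk => KZ.relations.sum_mem fun i hi => hS k hk i hi) hZ

end Summit.KontsevichZagierPeriods.HermiteRigidity.ReductionRigidity

end
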